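import Literature.AlgebraicGeometry.Motives.HodgeThetaSubalgebraUnitaryConstantRankLevi
import HarnessLib

/-!
# The `Θ`-subalgebra theorem for unitary multiplicities `(8, 15)` — the `r = 6` stall with `S ⊆ {3, 5, 6}`, closed
# classification-free by the inner double Levi and the constant-rank no-go (Ribet 1983 Thm. 3, Lie step; abelian
# 23-folds of type `(8, 15)`)

Family `hodge`, layer `Literature/AlgebraicGeometry/Motives` (pure linear algebra over `ℂ`; no geometry). Research
context: cell `pub-hodge-ring2` (HONEST FRAMING: research route conditional on HC_CM; not a corollary; Q11.4-sentence-2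
already refuted in dim ≥ 3), Literature lane gen 86, programme R73. UNCONDITIONAL; theorems only, no definition, no
named fact (D-0026), no `sorry`.

THE PRINT. K. A. Ribet, Amer. J. Math. 105 (1983), Thm. 3 = Gordon's survey Thm. 6.3 (3) [held
`paper:arxiv-alg-geom_9709030` p. 18]: `End⁰ = k` imaginary quadratic acting with coprime multiplicities `(n′, n″)` ⟹
`Hg = U(V, φ)`, `B•(Xⁿ) = D•(Xⁿ)`. The lane replaces Ribet's appeal to the classification of minuscule representations
pair by pair; `(8, 15)` is one of the two `p = 23` cells left open by lit-g84/g85 (README §HEIRS: «`r_max = 6`,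
`S ⊆ {3, 5, 6}`, Levi types `(6 | 9)`, `(2 | 6)`; residual profile `(2, 3)` only»).

THE ARGUMENT (`UnitaryEightFifteen.eq_top_of_smul`). Ranks `1, 2, 4, 7, 8` are «good» (larger-side Levi types
`(1|14)`, `(2|13)`, `(4|11)`, `(7|8)`, `(8|7)` are tree cores — `UnitaryDoubleLevi.eq_top_of_raise_of_core`), so if
`𝔊 ≠ End(W)` every raising operator has rank in `S ⊆ {0, 3, 5, 6}`; the Ψ-core route
(`UnitaryRaisingRank.exists_raise_rank_gt_of_psi_core` with the cores `(5|3)`, `(3|5)`) raises ranks `3` and `5`, so a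
raising `B` of rank `6` exists and is of maximal rank. Let `ι` be its involution (`U⁺ = (P ∩ ker C) ⊕ C(P)` of type
`(2 | 6)`, `U⁻ = B(W) ⊕ (Q ∩ ker B)` of type `(6 | 9)`), `L^±` the concrete Levi algebras
(`UnitaryLeviFull.levi_axioms`). For a raising `X` commuting with `ι` write `(i, j) = (rk X|_{U⁺}, rk X|_{U⁻})`,
`i ≤ 2`, `i + j ∈ S`. KILLS: `i = 1` (then `L⁺` is full by `UnitaryRankOneRaise.eq_top_of_rankOne_raise_two` and the
maximality polarisation `UnitaryLeviFull.exists_rankOne_raise_of_maxRank` gives rank `1 ∈ S`); `j = 1` (`L⁻` of type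
`(6 | 9)` full by `UnitaryRankOneRaise.eq_top_of_rankOne_raise`, then `UnitaryLeviFull.exists_rankOne_raise_of_full`);
`j = 4` (the `(4 | 5)` core `UnitaryFourOdd.eq_top` INSIDE `L⁻`: `UnitaryDoubleLevi.eq_top_of_raise_of_core`). Hence
`i = 2 ⟹ j = 3`, and some `X₀` has `i = 2` (`UnitaryLeviFull.exists_raise_commute_apply_ne_zero`). If `Y` commutes with
`ι` and vanishes on `U⁺`, then `X₀ + cY` has `i = 2`, so `rk (X₀ + cY)|_{U⁻} = 3` for every `c`, whence `rk Y|_{U⁻} ≤ 3`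
by the generic-rank lemma `UnitaryGenericRank.exists_finrank_le_finrank_range_add_smul`. So EVERY non-zero raising
element of `L⁻` (these are the `X|_{U⁻}`, `UnitaryLeviLift.exists_raise_restrict`) has rank exactly `3` — impossible for
an irreducible algebra of type `(6 | 9)` by `UnitarySix.exists_raise_rank_ne_three`. **`eq_top_of_smul'`** is the
mirror `(15, 8)`. (`ℂ`-homogeneity of `s` enters only through the `(7|8)`, `(8|7)` cores.) §2 **`UnitaryEight.eq_top_of_smul_twentythree`**:
the `(8 | 23)` core by one Euclid step (`UnitaryCoprimeStep.eq_top_of_onto_of_core`: a raising operator onto `P` by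
`UnitaryEight.exists_raise_onto_eight_of_smul`, and the `(8 | 15)` core on the Levi algebra of type `(8 | 23 − 8)`).

CONSEQUENCES (sequels under `HodgeTheory/`): Ribet's theorem at `(n′, n″) = (8, 15)` and `(8, 23)`; with the `(9 | 14)`
core, every simple complex abelian `23`-fold with `End⁰ ≠ ℚ` satisfies `B• = D•` on all powers; the `p = 31` cell
`{8, 23}`.

## References
* [Ribet1983] K. A. Ribet, *Hodge classes on certain types of abelian varieties*, Amer. J. Math. 105 (1983), Thm. 3.
* [Gordon1997] B. B. Gordon, *A survey of the Hodge conjecture for abelian varieties*, Thm. 6.3 (3), pp. 18–19.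
* [Deligne1982HodgeCycles] P. Deligne, *Hodge cycles on abelian varieties*, LNM 900 (1982), I §3 Prop. 3.4, 3.6.
* [GoodmanWallachGTM255] R. Goodman, N. R. Wallach, GTM 255 (2009), §4.1.1.
* [Humphreys1972] J. E. Humphreys, *Introduction to Lie Algebras and Representation Theory*, §19.1.
* [HoffmanKunze1971LinearAlgebra] K. Hoffman, R. Kunze, *Linear Algebra* (1971), §3.1 Thm. 2, §6.2, §6.7.
-/

noncomputable section

open Module

namespace Literature.AlgebraicGeometry.Motives

namespace HodgeStructure

universe u

variable {W : Type u} [AddCommGroup W] [Module ℂ W]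

/-- **THE `Θ`-SUBALGEBRA THEOREM FOR UNITARY MULTIPLICITIES `(8, 15)` — complex Hermitian core, classification-free.**
`𝔊 ⊆ End(W)` bracket-closed and irreducible, `Θ ∈ 𝔊` an involution with `dim P = 8`, `dim Q = 15`, Hermitian data
(`s` additive and `ℂ`-homogeneous in the first slot, Hermitian-symmetric, `P ⊥ Q`, definite on `P` and on `Q`), `𝔊`
adjoint-closed ⟹ `𝔊 = End(W)`. See the module docstring. [cite: Ribet1983, Thm. 3] [cite: Gordon1997, Thm. 6.3 (3)]
[cite: Deligne1982HodgeCycles, I §3 Prop. 3.4, 3.6] [cite: GoodmanWallachGTM255, §4.1.1] -/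
theorem UnitaryEightFifteen.eq_top_of_smul [FiniteDimensional ℂ W] {𝔊 : Submodule ℂ (Module.End ℂ W)}
    (hbr : ∀ Y ∈ 𝔊, ∀ Z ∈ 𝔊, Y * Z - Z * Y ∈ 𝔊)
    (hirr : ∀ U : Submodule ℂ W, (∀ A ∈ 𝔊, ∀ u ∈ U, A u ∈ U) → U = ⊥ ∨ U = ⊤)
    {Θ : Module.End ℂ W} (hΘ : Θ ∈ 𝔊) (hΘΘ : Θ * Θ = 1)
    {P Q : Submodule ℂ W} (hP : ∀ x, x ∈ P ↔ Θ x = x) (hQ : ∀ x, x ∈ Q ↔ Θ x = -x)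
    (hP8 : Module.finrank ℂ P = 8) (hQ15 : Module.finrank ℂ Q = 15)
    {s : W → W → ℂ} (hadd : ∀ x y z, s (x + y) z = s x z + s y z)
    (hsmul : ∀ (c : ℂ) (x y : W), s (c • x) y = c * s x y) (hsymm : ∀ x y, s y x = starRingEnd ℂ (s x y))
    (hPQ : ∀ p ∈ P, ∀ q ∈ Q, s p q = 0) (hdefP : ∀ p ∈ P, s p p = 0 → p = 0) (hdefQ : ∀ q ∈ Q, s q q = 0 → q = 0)
    (hadj : ∀ X ∈ 𝔊, ∃ Y ∈ 𝔊, ∀ x y, s (X x) y = s x (Y y)) : 𝔊 = ⊤ := by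
  classical
  obtain ⟨haddr, h0r, h0l, hnegr, hnegl, hsubr, hsubl⟩ := UnitaryTwoOdd.herm_right hadd hsymm
  have hΘΘv : ∀ v, Θ (Θ v) = v := fun v => by rw [← Module.End.mul_apply, hΘΘ, Module.End.one_apply]
  have hraiseval : ∀ Z : Module.End ℂ W, Θ * Z = Z → ∀ w, Z w ∈ P := fun Z hΘZ w =>
    (hP _).2 (by rw [← Module.End.mul_apply, hΘZ])
  have hle8 : ∀ B' : Module.End ℂ W, Θ * B' = B' → Module.finrank ℂ (LinearMap.range B') ≤ 8 := fun B' h => by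
    rw [← hP8]
    exact Submodule.finrank_mono (by rintro _ ⟨w, rfl⟩; exact hraiseval B' h w)
  have hrk0 : ∀ B' : Module.End ℂ W, Module.finrank ℂ (LinearMap.range B') = 0 → B' = 0 := fun B' h =>
    LinearMap.range_eq_bot.1 (Submodule.finrank_eq_zero.1 h)
  -- the Hermitian data restricted to a subspace
  have hsU : ∀ U : Submodule ℂ W, ∀ x y z : U, s ((x + y : U) : W) z = s (x : W) z + s (y : W) z :=
    fun U x y z => by simp only [Submodule.coe_add, hadd]
  have hsmU : ∀ U : Submodule ℂ W, ∀ (c : ℂ) (x y : U), s ((c • x : U) : W) y = c * s (x : W) y :=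
    fun U c x y => by simp only [Submodule.coe_smul, hsmul]
  -- STEP 1: the good ranks `1, 2, 4, 7, 8`
  have key : ∀ B' ∈ 𝔊, Θ * B' = B' → B' * Θ = -B' →
      (Module.finrank ℂ (LinearMap.range B') = 1 ∨ Module.finrank ℂ (LinearMap.range B') = 2 ∨
        Module.finrank ℂ (LinearMap.range B') = 4 ∨ Module.finrank ℂ (LinearMap.range B') = 7 ∨
        Module.finrank ℂ (LinearMap.range B') = 8) → 𝔊 = ⊤ := by
    intro B' hB' hΘB' hB'Θ hr
    refine UnitaryDoubleLevi.eq_top_of_raise_of_core hbr hirr hΘ hΘΘ hP hQ hadd hsymm hPQ hdefP hdefQ hadj hB' hΘB' hB'Θ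
      (by omega) (by omega) (by omega)
      fun U 𝔩 ι P' Q' hbr𝔩 hirr𝔩 hι hιι hP' hQ' hfinP' hfinQ' hP'Q' hdefP' hdefQ' hadj𝔩 => ?_
    rw [hQ15] at hfinQ'
    rcases hr with h | h | h | h | h <;> rw [h] at hfinP' hfinQ'
    · -- `(1 | 14)`: the `(m, 1)` core for `−ι`
      exact UnitaryThreeCoprime.eq_top_of_finrank_eq_one hbr𝔩 hirr𝔩 (Submodule.neg_mem _ hι)
        ((neg_mul_neg ι ι).trans hιι) (P := Q') (Q := P') (fun x => by rw [hQ', LinearMap.neg_apply, neg_eq_iff_eq_neg])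
        (fun x => by rw [hP', LinearMap.neg_apply, neg_inj]) (by omega) hfinP'
    · -- `(2 | 13)`
      exact UnitaryTwoOdd.eq_top hbr𝔩 hirr𝔩 hι hιι hP' hQ' hfinP' ⟨6, by omega⟩ (s := fun x y : U => s (x : W) y)
        (hsU U) (fun x y => hsymm x y) hP'Q' hdefP' hdefQ' hadj𝔩
    · -- `(4 | 11)`
      exact UnitaryFourOdd.eq_top hbr𝔩 hirr𝔩 hι hιι hP' hQ' hfinP' ⟨5, by omega⟩ (s := fun x y : U => s (x : W) y)
        (hsU U) (fun x y => hsymm x y) hP'Q' hdefP' hdefQ' hadj𝔩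
    · -- `(7 | 8)`
      exact UnitarySeven.eq_top_of_smul hbr𝔩 hirr𝔩 hι hιι hP' hQ' hfinP' (by omega) (s := fun x y : U => s (x : W) y)
        (hsU U) (hsmU U) (fun x y => hsymm x y) hP'Q' hdefP' hdefQ' hadj𝔩
    · -- `(8 | 7)`
      exact UnitaryEight.eq_top_of_smul hbr𝔩 hirr𝔩 hι hιι hP' hQ' hfinP' ⟨3, by omega⟩ (by omega) (by omega)
        (s := fun x y : U => s (x : W) y) (hsU U) (hsmU U) (fun x y => hsymm x y) hP'Q' hdefP' hdefQ' hadj𝔩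
  -- STEP 2: otherwise every raising operator has rank in `{0, 3, 5, 6}`
  by_contra hne
  have hbad : ∀ B' ∈ 𝔊, Θ * B' = B' → B' * Θ = -B' →
      Module.finrank ℂ (LinearMap.range B') = 0 ∨ Module.finrank ℂ (LinearMap.range B') = 3 ∨
        Module.finrank ℂ (LinearMap.range B') = 5 ∨ Module.finrank ℂ (LinearMap.range B') = 6 := by
    intro B' hB' hΘB' hB'Θ
    have h8 := hle8 B' hΘB'
    have hk : ¬ (Module.finrank ℂ (LinearMap.range B') = 1 ∨ Module.finrank ℂ (LinearMap.range B') = 2 ∨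
        Module.finrank ℂ (LinearMap.range B') = 4 ∨ Module.finrank ℂ (LinearMap.range B') = 7 ∨
        Module.finrank ℂ (LinearMap.range B') = 8) :=
      fun h => hne (key B' hB' hΘB' hB'Θ h)
    omega
  have hno1 : ∀ B' ∈ 𝔊, Θ * B' = B' → B' * Θ = -B' → Module.finrank ℂ (LinearMap.range B') ≠ 1 := by
    intro B' hB' hΘB' hB'Θ h1
    rcases hbad B' hB' hΘB' hB'Θ with h | h | h | h <;> omega
  -- STEP 3: the Ψ-core route raises the ranks `3` and `5`; a raising operator of rank `6` exists and is maximal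
  have hup : ∀ B' ∈ 𝔊, Θ * B' = B' → B' * Θ = -B' →
      (Module.finrank ℂ (LinearMap.range B') = 3 ∨ Module.finrank ℂ (LinearMap.range B') = 5) →
      ∃ B'' ∈ 𝔊, Θ * B'' = B'' ∧ B'' * Θ = -B'' ∧
        Module.finrank ℂ (LinearMap.range B') < Module.finrank ℂ (LinearMap.range B'') := by
    intro B' hB' hΘB' hB'Θ hr
    refine UnitaryRaisingRank.exists_raise_rank_gt_of_psi_core hbr hirr hΘ hΘΘ hP hQ hB' hΘB' hB'Θ (by omega)
      (by rw [hP8]; omega) (by rw [hQ15]; omega) hadd hsymm hPQ hdefP hdefQ hadj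
      fun U 𝔩 ι P' Q' hbr𝔩 hirr𝔩 hι hιι hP' hQ' hfinP' hfinQ' hP'Q' hdefP' hdefQ' hadj𝔩 => ?_
    rw [hP8] at hfinP'
    rcases hr with h | h <;> rw [h] at hfinP' hfinQ'
    · -- rank `3`: the `(5 | 3)` core
      exact UnitaryThreeCoprime.eq_top' hbr𝔩 hirr𝔩 hι hιι hP' hQ' (by omega) hfinQ'
        (s := fun x y : U => s (x : W) y) (hsU U) (fun x y => hsymm x y) hP'Q' hdefP' hdefQ' hadj𝔩
    · -- rank `5`: the `(3 | 5)` core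
      exact UnitaryThreeCoprime.eq_top hbr𝔩 hirr𝔩 hι hιι hP' hQ' (by omega) (by omega)
        (s := fun x y : U => s (x : W) y) (hsU U) (fun x y => hsymm x y) hP'Q' hdefP' hdefQ' hadj𝔩
  have h6ex : ∃ B ∈ 𝔊, Θ * B = B ∧ B * Θ = -B ∧ Module.finrank ℂ (LinearMap.range B) = 6 := by
    obtain ⟨B₂, hB₂, hΘB₂, hB₂Θ, hr2⟩ :=
      UnitaryThreeCoprime.exists_raise_rank_ge_two hbr hirr hΘ hΘΘ hP hQ (by omega) (by omega)
    have hfive : ∀ B' ∈ 𝔊, Θ * B' = B' → B' * Θ = -B' → Module.finrank ℂ (LinearMap.range B') = 5 →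
        ∃ B ∈ 𝔊, Θ * B = B ∧ B * Θ = -B ∧ Module.finrank ℂ (LinearMap.range B) = 6 := by
      intro B' hB' hΘB' hB'Θ h5
      obtain ⟨B'', hB'', hΘB'', hB''Θ, hgt⟩ := hup B' hB' hΘB' hB'Θ (Or.inr h5)
      have h8 := hle8 B'' hΘB''
      refine ⟨B'', hB'', hΘB'', hB''Θ, ?_⟩
      rcases hbad B'' hB'' hΘB'' hB''Θ with h' | h' | h' | h' <;> omega
    rcases hbad B₂ hB₂ hΘB₂ hB₂Θ with h | h | h | h
    · omega
    · obtain ⟨B'', hB'', hΘB'', hB''Θ, hgt⟩ := hup B₂ hB₂ hΘB₂ hB₂Θ (Or.inl h)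
      rcases hbad B'' hB'' hΘB'' hB''Θ with h' | h' | h' | h'
      · omega
      · omega
      · exact hfive B'' hB'' hΘB'' hB''Θ h'
      · exact ⟨B'', hB'', hΘB'', hB''Θ, h'⟩
    · exact hfive B₂ hB₂ hΘB₂ hB₂Θ h
    · exact ⟨B₂, hB₂, hΘB₂, hB₂Θ, h⟩
  obtain ⟨B, hB, hΘB, hBΘ, h6⟩ := h6ex
  have hmax : ∀ B' ∈ 𝔊, Θ * B' = B' → B' * Θ = -B' →
      Module.finrank ℂ (LinearMap.range B') ≤ Module.finrank ℂ (LinearMap.range B) := by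
    intro B' hB' hΘB' hB'Θ
    rcases hbad B' hB' hΘB' hB'Θ with h | h | h | h <;> omega
  -- STEP 4: the involution `ι` of `B`; `U⁺` of type `(2 | 6)`, `U⁻` of type `(6 | 9)`
  obtain ⟨C, hC, ι, hιmem, hBC, hΘC, hCΘ, hιι, hιΘ, hιs, hιa, hιd, hιb, hιc, hmemA, hmemD, hmemB, hmemC, hfinP₀, hfinQ₀,
    hfinQU, hrangeP, hmapCQ, hfinUm, hfinUp⟩ :=
    UnitaryLeviKernel.exists_involution hbr hΘ hΘΘ hP hQ hadd hsymm hPQ hdefP hdefQ hadj hB hΘB hBΘ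
  have hιv : ∀ v, ι (ι v) = v := fun v => by rw [← Module.End.mul_apply, hιι, Module.End.one_apply]
  rw [h6, hP8] at hfinP₀
  rw [h6, hQ15] at hfinQ₀
  rw [h6] at hfinQU
  have hP₀2 : Module.finrank ℂ ↥(P ⊓ LinearMap.ker C) = 2 := by omega
  have hQ₀9 : Module.finrank ℂ ↥(Q ⊓ LinearMap.ker B) = 9 := by omega
  rw [hQ15] at hfinUm
  rw [hP8] at hfinUp
  set Um : Submodule ℂ W := LinearMap.ker (ι + 1) with hUmdef
  set Up : Submodule ℂ W := LinearMap.ker (ι - 1) with hUpdef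
  have hUm : ∀ x, x ∈ Um ↔ ι x = -x := fun x => by
    rw [hUmdef, LinearMap.mem_ker, LinearMap.add_apply, Module.End.one_apply, add_eq_zero_iff_eq_neg]
  have hUp : ∀ x, x ∈ Up ↔ ι x = x := fun x => by
    rw [hUpdef, LinearMap.mem_ker, LinearMap.sub_apply, Module.End.one_apply, sub_eq_zero]
  have hcm : ∀ Z : Module.End ℂ W, Z * ι = ι * Z → ∀ x ∈ Um, Z x ∈ Um := fun Z hZ x hx =>
    (hUm _).2 (by rw [← Module.End.mul_apply, ← hZ, Module.End.mul_apply, (hUm x).1 hx, map_neg])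
  have hcp : ∀ Z : Module.End ℂ W, Z * ι = ι * Z → ∀ x ∈ Up, Z x ∈ Up := fun Z hZ x hx =>
    (hUp _).2 (by rw [← Module.End.mul_apply, ← hZ, Module.End.mul_apply, (hUp x).1 hx])
  obtain ⟨Im, Ip, Lm, Lp, -, -, hLm, hLp, -⟩ := UnitaryLeviKernel.exists_kernel_levi 𝔊 hιι hUm hUp
  -- rank bookkeeping for raising operators commuting with `ι`
  have hsplit : ∀ X : Module.End ℂ W, Θ * X = X → X * ι = ι * X →
      Module.finrank ℂ (LinearMap.range X) = Module.finrank ℂ (Up.map X) + Module.finrank ℂ (Um.map X) ∧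
        Module.finrank ℂ (Up.map X) ≤ 2 ∧ Module.finrank ℂ (Um.map X) ≤ 6 := by
    intro X hΘX hXc
    refine ⟨UnitaryLeviRank.finrank_range_eq_add hιι hUm hUp hXc, ?_, ?_⟩
    · have hle : Up.map X ≤ P ⊓ LinearMap.ker C := by
        rintro _ ⟨x, hx, rfl⟩
        exact hmemB _ ((hUp _).1 (hcp X hXc x hx)) (by rw [← Module.End.mul_apply, hΘX])
      exact (Submodule.finrank_mono hle).trans (by omega)
    · have hle : Um.map X ≤ LinearMap.range B := by
        rintro _ ⟨x, hx, rfl⟩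
        exact hmemA _ ((hUm _).1 (hcm X hXc x hx)) (by rw [← Module.End.mul_apply, hΘX])
      exact (Submodule.finrank_mono hle).trans (by omega)
  -- the concrete Levi algebra `L⁻` (type `(6 | 9)`) satisfies the axioms
  have hPUle : LinearMap.range B ≤ Um := fun x hx => (hUm x).2 (hιa x hx)
  have hQUle : Q ⊓ LinearMap.ker B ≤ Um := fun d hd => (hUm d).2 (hιd d hd)
  have hPUmem : ∀ x ∈ Um, Θ x = x → x ∈ LinearMap.range B := fun x hx hΘx => hmemA x ((hUm x).1 hx) hΘx
  have hPUΘ : ∀ x ∈ LinearMap.range B, Θ x = x := fun x hx => (hP x).1 (hrangeP hx)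
  have hQUmem : ∀ x ∈ Um, Θ x = -x → x ∈ Q ⊓ LinearMap.ker B := fun x hx hΘx => hmemD x ((hUm x).1 hx) hΘx
  have hQUΘ : ∀ x ∈ Q ⊓ LinearMap.ker B, Θ x = -x := fun x hx => (hQ x).1 (Submodule.mem_inf.1 hx).1
  have hPUQU : ∀ x ∈ LinearMap.range B, ∀ y ∈ Q ⊓ LinearMap.ker B, s x y = 0 := fun x hx y hy =>
    hPQ x (hrangeP hx) y (Submodule.mem_inf.1 hy).1
  have hdefPU : ∀ x ∈ LinearMap.range B, s x x = 0 → x = 0 := fun x hx h => hdefP x (hrangeP hx) h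
  have hdefQU : ∀ y ∈ Q ⊓ LinearMap.ker B, s y y = 0 → y = 0 := fun y hy h =>
    hdefQ y (Submodule.mem_inf.1 hy).1 h
  obtain ⟨ιm, Pm, Qm, hιmapply, hPmmem, hQmmem, hbrLm, hirrLm, hιmmem, hιmιm, hPm, hQm, hfinPm, hfinQm, hPmQm, hdefPm,
    hdefQm, hadjLm, -, -⟩ :=
    UnitaryLeviFull.levi_axioms hbr hirr hΘΘ hP hQ hadd hsymm hPQ hdefP hdefQ hadj hιmem hιι hιs hΘ hΘΘ hιΘ hUm hPUle
      hQUle hPUmem hPUΘ hQUmem hQUΘ hPUQU hdefPU hdefQU hLm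
  rw [h6] at hfinPm
  rw [hQ₀9] at hfinQm
  have hfullm_of : Lm = ⊤ → False := by
    intro hLmtop
    have hfullm : ∀ T : Module.End ℂ Um, ∃ Z ∈ 𝔊, Z * ι = ι * Z ∧ ∀ v : Um, ((T v : Um) : W) = Z v := fun T =>
      (hLm T).1 (by rw [hLmtop]; exact Submodule.mem_top)
    obtain ⟨⟨u, hu⟩, hu0⟩ := Module.finrank_pos_iff_exists_ne_zero.1
      (show 0 < Module.finrank ℂ (LinearMap.range B) by omega)
    have hu0' : u ≠ 0 := fun h => hu0 (Subtype.ext h)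
    obtain ⟨⟨q₀, hq₀⟩, hq₀0⟩ := Module.finrank_pos_iff_exists_ne_zero.1
      (show 0 < Module.finrank ℂ ↥(Q ⊓ LinearMap.ker B) by omega)
    have hq₀0' : q₀ ≠ 0 := fun h => hq₀0 (Subtype.ext h)
    obtain ⟨B₁, hB₁, hΘB₁, hB₁Θ, hr1⟩ := UnitaryLeviFull.exists_rankOne_raise_of_full hbr hΘΘ hιι hιΘ hUm hUp hfullm
      (by omega) (by omega) (hPUΘ u hu) (hιa u hu) hu0' (hQUΘ q₀ hq₀) (hιd q₀ hq₀) hq₀0'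
    exact hno1 B₁ hB₁ hΘB₁ hB₁Θ hr1
  -- the concrete Levi algebra `L⁺` (involution `−ι`; type `(2 | 6)`) satisfies the axioms
  have hnι : -ι ∈ 𝔊 := Submodule.neg_mem _ hιmem
  have hnιι : (-ι) * (-ι) = 1 := by rw [neg_mul_neg, hιι]
  have hnιs : ∀ v w, s ((-ι) v) w = s v ((-ι) w) := fun v w => by
    rw [LinearMap.neg_apply, LinearMap.neg_apply, hnegl, hnegr, hιs]
  have hnιΘ : (-ι) * Θ = Θ * (-ι) := by rw [neg_mul, mul_neg, hιΘ]
  have hUp' : ∀ v, v ∈ Up ↔ (-ι) v = -v := fun v => by rw [hUp, LinearMap.neg_apply, neg_inj]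
  have hPUle' : P ⊓ LinearMap.ker C ≤ Up := fun v hv => (hUp v).2 (hιb v hv)
  have hQUle' : P.map C ≤ Up := fun v hv => (hUp v).2 (hιc v hv)
  have hPUmem' : ∀ v ∈ Up, Θ v = v → v ∈ P ⊓ LinearMap.ker C := fun v hv hΘv => hmemB v ((hUp v).1 hv) hΘv
  have hPUΘ' : ∀ v ∈ P ⊓ LinearMap.ker C, Θ v = v := fun v hv => (hP v).1 (Submodule.mem_inf.1 hv).1
  have hQUmem' : ∀ v ∈ Up, Θ v = -v → v ∈ P.map C := fun v hv hΘv => hmemC v ((hUp v).1 hv) hΘv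
  have hQUΘ' : ∀ v ∈ P.map C, Θ v = -v := fun v hv => (hQ v).1 (hmapCQ hv)
  have hPUQU' : ∀ v ∈ P ⊓ LinearMap.ker C, ∀ w ∈ P.map C, s v w = 0 := fun v hv w hw =>
    hPQ v (Submodule.mem_inf.1 hv).1 w (hmapCQ hw)
  have hdefPU' : ∀ v ∈ P ⊓ LinearMap.ker C, s v v = 0 → v = 0 := fun v hv h =>
    hdefP v (Submodule.mem_inf.1 hv).1 h
  have hdefQU' : ∀ w ∈ P.map C, s w w = 0 → w = 0 := fun w hw h => hdefQ w (hmapCQ hw) h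
  have hLp' : ∀ A, A ∈ Lp ↔ ∃ Z ∈ 𝔊, Z * (-ι) = (-ι) * Z ∧ ∀ v : Up, ((A v : Up) : W) = Z v := fun A => by
    rw [hLp]
    constructor
    · rintro ⟨Z, hZ, hZc, hZv⟩; exact ⟨Z, hZ, by rw [mul_neg, neg_mul, hZc], hZv⟩
    · rintro ⟨Z, hZ, hZc, hZv⟩; exact ⟨Z, hZ, by rw [mul_neg, neg_mul, neg_inj] at hZc; exact hZc, hZv⟩
  obtain ⟨ιp, Pp, Qp, hιpapply, hPpmem, hQpmem, hbrLp, hirrLp, hιpmem, hιpιp, hPp, hQp, hfinPp, hfinQp, hPpQp, hdefPp,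
    hdefQp, hadjLp, -, -⟩ :=
    UnitaryLeviFull.levi_axioms hbr hirr hΘΘ hP hQ hadd hsymm hPQ hdefP hdefQ hadj hnι hnιι hnιs hΘ hΘΘ hnιΘ hUp'
      hPUle' hQUle' hPUmem' hPUΘ' hQUmem' hQUΘ' hPUQU' hdefPU' hdefQU' hLp'
  rw [hP₀2] at hfinPp
  rw [hfinQU] at hfinQp
  -- a non-zero vector of `C(P) = Q ∩ U⁺` and two independent vectors of `P ∩ ker C = P ∩ U⁺`
  have hp0 : ∃ p, p ≠ 0 ∧ ι p = p ∧ Θ p = p := by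
    obtain ⟨⟨p, hp⟩, hp0⟩ := Module.finrank_pos_iff_exists_ne_zero.1
      (show 0 < Module.finrank ℂ ↥(P ⊓ LinearMap.ker C) by omega)
    exact ⟨p, fun h => hp0 (Subtype.ext h), hιb p hp, (hP p).1 (Submodule.mem_inf.1 hp).1⟩
  have hq0 : ∃ q, q ≠ 0 ∧ ι q = q ∧ Θ q = -q := by
    obtain ⟨⟨q, hq⟩, hq0⟩ := Module.finrank_pos_iff_exists_ne_zero.1
      (show 0 < Module.finrank ℂ ↥(P.map C) by omega)
    exact ⟨q, fun h => hq0 (Subtype.ext h), hιc q hq, (hQ q).1 (hmapCQ hq)⟩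
  obtain ⟨c₁, hc₁0, hιc₁, hΘc₁⟩ := hq0
  obtain ⟨⟨e₁, he₁⟩, he₁0⟩ := Module.finrank_pos_iff_exists_ne_zero.1
    (show 0 < Module.finrank ℂ ↥(P ⊓ LinearMap.ker C) by omega)
  have he₁0' : e₁ ≠ 0 := fun h => he₁0 (Subtype.ext h)
  have hex₂ : ∃ e₂ ∈ P ⊓ LinearMap.ker C, e₂ ∉ ℂ ∙ e₁ := by
    by_contra hall
    push Not at hall
    have hle : P ⊓ LinearMap.ker C ≤ ℂ ∙ e₁ := fun v hv => hall v hv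
    have := (Submodule.finrank_mono hle).trans (finrank_span_singleton he₁0').le
    omega
  obtain ⟨e₂, he₂, he₂1⟩ := hex₂
  have hind : ∀ a b : ℂ, a • e₁ + b • e₂ = 0 → a = 0 ∧ b = 0 := by
    intro a b hab
    by_cases hb : b = 0
    · rw [hb, zero_smul, add_zero] at hab
      exact ⟨(smul_eq_zero.1 hab).resolve_right he₁0', hb⟩
    · exfalso
      apply he₂1
      rw [Submodule.mem_span_singleton]
      refine ⟨-(b⁻¹ * a), ?_⟩
      have : e₂ = b⁻¹ • (b • e₂) := by rw [smul_smul, inv_mul_cancel₀ hb, one_smul]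
      rw [this, eq_neg_of_add_eq_zero_right hab]
      module
  -- STEP 5: the three kills
  -- (K1) no raising `X` commuting with `ι` has `rk X|_{U⁺} = 1`
  have hkillp1 : ∀ X ∈ 𝔊, Θ * X = X → X * Θ = -X → X * ι = ι * X → Module.finrank ℂ (Up.map X) ≠ 1 := by
    intro X hX hΘX hXΘ hXc hXUp
    set y : Module.End ℂ Up := X.restrict (hcp X hXc) with hydef
    have hyval : ∀ v : Up, ((y v : Up) : W) = X v := fun v => rfl
    have hymem : y ∈ Lp := (hLp y).2 ⟨X, hX, hXc, hyval⟩
    have hιpy : ιp * y = y := LinearMap.ext fun v => Subtype.ext (by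
      rw [Module.End.mul_apply, hιpapply, hyval, ← Module.End.mul_apply, hΘX])
    have hyιp : y * ιp = -y := LinearMap.ext fun v => Subtype.ext (by
      rw [Module.End.mul_apply, LinearMap.neg_apply, Submodule.coe_neg, hyval, hιpapply, ← Module.End.mul_apply, hXΘ,
        LinearMap.neg_apply, hyval])
    have hyrk : Module.finrank ℂ (LinearMap.range y) = 1 := by
      rw [hydef, UnitaryLeviRank.finrank_range_restrict, hXUp]
    have hLptop : Lp = ⊤ :=
      UnitaryRankOneRaise.eq_top_of_rankOne_raise_two hbrLp hirrLp hιpmem hιpιp hPp hQp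
        (s := fun v w : Up => s (v : W) w) (hsU Up) (fun v w => hsymm v w) hPpQp hdefPp hdefQp hadjLp hymem hιpy hyιp
        hyrk hfinPp (by rw [hfinQp]; norm_num)
    have hfullp : ∀ T : Module.End ℂ Up, ∃ Z ∈ 𝔊, Z * ι = ι * Z ∧ ∀ v : Up, ((T v : Up) : W) = Z v := fun T =>
      (hLp T).1 (by rw [hLptop]; exact Submodule.mem_top)
    obtain ⟨B₁, hB₁, hΘB₁, hB₁Θ, hr1⟩ := UnitaryLeviFull.exists_rankOne_raise_of_maxRank hbr hΘ hΘΘ hB hΘB hBΘ hmax hιι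
      hιΘ (fun w => hιa _ (LinearMap.mem_range_self B w))
      (fun v hιv' hΘv => LinearMap.mem_ker.1 (Submodule.mem_inf.1 (hmemD v hιv' hΘv)).2)
      (fun v hΘv hBv => hιd v (Submodule.mem_inf.2 ⟨(hQ v).2 hΘv, LinearMap.mem_ker.2 hBv⟩)) hUp hfullp
      (hPUΘ' e₁ he₁) (hιb e₁ he₁) (hPUΘ' e₂ he₂) (hιb e₂ he₂) hind hΘc₁ hιc₁ hc₁0
    exact hno1 B₁ hB₁ hΘB₁ hB₁Θ hr1
  -- (K2) no raising `X` commuting with `ι` has `rk X|_{U⁻} = 1` or `= 4`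
  have hkillm : ∀ X ∈ 𝔊, Θ * X = X → X * Θ = -X → X * ι = ι * X →
      Module.finrank ℂ (Um.map X) ≠ 1 ∧ Module.finrank ℂ (Um.map X) ≠ 4 := by
    intro X hX hΘX hXΘ hXc
    set x : Module.End ℂ Um := X.restrict (hcm X hXc) with hxdef
    have hxval : ∀ v : Um, ((x v : Um) : W) = X v := fun v => rfl
    have hxmem : x ∈ Lm := (hLm x).2 ⟨X, hX, hXc, hxval⟩
    have hιmx : ιm * x = x := LinearMap.ext fun v => Subtype.ext (by
      rw [Module.End.mul_apply, hιmapply, hxval, ← Module.End.mul_apply, hΘX])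
    have hxιm : x * ιm = -x := LinearMap.ext fun v => Subtype.ext (by
      rw [Module.End.mul_apply, LinearMap.neg_apply, Submodule.coe_neg, hxval, hιmapply, ← Module.End.mul_apply, hXΘ,
        LinearMap.neg_apply, hxval])
    have hxrk : Module.finrank ℂ (LinearMap.range x) = Module.finrank ℂ (Um.map X) := by
      rw [hxdef, UnitaryLeviRank.finrank_range_restrict]
    constructor
    · intro h1
      rw [h1] at hxrk
      exact hfullm_of (UnitaryRankOneRaise.eq_top_of_rankOne_raise hbrLm hirrLm hιmmem hιmιm hPm hQm
        (s := fun v w : Um => s (v : W) w) (hsU Um) (fun v w => hsymm v w) hPmQm hdefPm hdefQm hadjLm hxmem hιmx hxιm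
        hxrk (by rw [hfinPm, hfinQm]; norm_num) (by rw [hfinPm]; norm_num) (by rw [hfinQm]; norm_num))
    · intro h4
      rw [h4] at hxrk
      refine hfullm_of (UnitaryDoubleLevi.eq_top_of_raise_of_core hbrLm hirrLm hιmmem hιmιm hPm hQm
        (s := fun v w : Um => s (v : W) w) (hsU Um) (fun v w => hsymm v w) hPmQm hdefPm hdefQm hadjLm hxmem hιmx hxιm
        (by rw [hxrk]; norm_num) (by rw [hfinPm]; norm_num) (by rw [hfinPm, hfinQm]; norm_num)
        fun U' 𝔩' ι' P' Q' hbr𝔩' hirr𝔩' hι' hι'ι' hP' hQ' hfinP' hfinQ' hP'Q' hdefP' hdefQ' hadj𝔩' => ?_)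
      rw [hxrk] at hfinP' hfinQ'
      rw [hfinQm] at hfinQ'
      -- the `(4 | 5)` core inside `L⁻`
      exact UnitaryFourOdd.eq_top hbr𝔩' hirr𝔩' hι' hι'ι' hP' hQ' hfinP' ⟨2, by omega⟩
        (s := fun v w : U' => s ((v : Um) : W) w) (fun v w z => by simp only [Submodule.coe_add, hadd])
        (fun v w => hsymm _ _) hP'Q' hdefP' hdefQ' hadj𝔩'
  -- STEP 6: profiles — `rk X|_{U⁺} ∈ {0, 2}`, and `rk X|_{U⁺} = 2 ⟹ rk X|_{U⁻} = 3`
  have hprof : ∀ X ∈ 𝔊, Θ * X = X → X * Θ = -X → X * ι = ι * X →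
      (Module.finrank ℂ (Up.map X) = 0 ∨ Module.finrank ℂ (Up.map X) = 2) ∧
        (Module.finrank ℂ (Up.map X) = 2 → Module.finrank ℂ (Um.map X) = 3) := by
    intro X hX hΘX hXΘ hXc
    obtain ⟨hs, hi, hj⟩ := hsplit X hΘX hXc
    have h1 := hkillp1 X hX hΘX hXΘ hXc
    obtain ⟨hm1, hm4⟩ := hkillm X hX hΘX hXΘ hXc
    have hr := hbad X hX hΘX hXΘ
    rw [hs] at hr
    constructor
    · omega
    · intro h2; omega
  -- STEP 7: `X₀` with `rk X₀|_{U⁺} = 2`; then every `Y ∈ 𝔷₊` vanishing on `U⁺` has `rk Y|_{U⁻} ≤ 3` (generic rank)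
  obtain ⟨X₀, hX₀, hΘX₀, hX₀Θ, hX₀c, c, hιc', hΘc, hX₀c0⟩ :=
    UnitaryLeviFull.exists_raise_commute_apply_ne_zero hbr hirr hΘ hΘΘ hQ hιmem hιι hιΘ hUm hUp hp0 ⟨c₁, hc₁0, hιc₁, hΘc₁⟩
  have hcUp : c ∈ Up := (hUp c).2 hιc'
  have hX₀Up : Module.finrank ℂ (Up.map X₀) = 2 := by
    rcases (hprof X₀ hX₀ hΘX₀ hX₀Θ hX₀c).1 with h | h
    · exfalso
      have : X₀ c ∈ Up.map X₀ := Submodule.mem_map_of_mem hcUp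
      rw [Submodule.finrank_eq_zero.1 h, Submodule.mem_bot] at this
      exact hX₀c0 this
    · exact h
  have hK : ∀ Y ∈ 𝔊, Θ * Y = Y → Y * Θ = -Y → Y * ι = ι * Y → Module.finrank ℂ (Up.map Y) = 0 →
      Module.finrank ℂ (Um.map Y) ≤ 3 := by
    intro Y hY hΘY hYΘ hYc hYUp
    have hY0 : ∀ v ∈ Up, Y v = 0 := fun v hv => by
      have : Y v ∈ Up.map Y := Submodule.mem_map_of_mem hv
      rwa [Submodule.finrank_eq_zero.1 hYUp, Submodule.mem_bot] at this
    set y : Module.End ℂ Um := Y.restrict (hcm Y hYc) with hydef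
    set x₀ : Module.End ℂ Um := X₀.restrict (hcm X₀ hX₀c) with hx₀def
    obtain ⟨c', hc'⟩ := UnitaryGenericRank.exists_finrank_le_finrank_range_add_smul y x₀
    set X₁ : Module.End ℂ W := X₀ + c' • Y with hX₁def
    have hX₁ : X₁ ∈ 𝔊 := Submodule.add_mem _ hX₀ (Submodule.smul_mem _ _ hY)
    have hΘX₁ : Θ * X₁ = X₁ := by rw [hX₁def, mul_add, mul_smul_comm, hΘX₀, hΘY]
    have hX₁Θ : X₁ * Θ = -X₁ := by rw [hX₁def, add_mul, smul_mul_assoc, hX₀Θ, hYΘ, smul_neg, neg_add]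
    have hX₁c : X₁ * ι = ι * X₁ := by rw [hX₁def, add_mul, smul_mul_assoc, mul_add, mul_smul_comm, hX₀c, hYc]
    have hX₁Up : Up.map X₁ = Up.map X₀ := by
      apply le_antisymm
      · rintro _ ⟨v, hv, rfl⟩
        exact ⟨v, hv, by rw [hX₁def, LinearMap.add_apply, LinearMap.smul_apply, hY0 v hv, smul_zero, add_zero]⟩
      · rintro _ ⟨v, hv, rfl⟩
        exact ⟨v, hv, by rw [hX₁def, LinearMap.add_apply, LinearMap.smul_apply, hY0 v hv, smul_zero, add_zero]⟩
    have hX₁Um : Module.finrank ℂ (Um.map X₁) = 3 :=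
      (hprof X₁ hX₁ hΘX₁ hX₁Θ hX₁c).2 (by rw [hX₁Up, hX₀Up])
    have hres : X₁.restrict (hcm X₁ hX₁c) = x₀ + c' • y := LinearMap.ext fun v => Subtype.ext (by
      simp only [LinearMap.coe_restrict_apply, hX₁def, LinearMap.add_apply, LinearMap.smul_apply, Submodule.coe_add,
        Submodule.coe_smul, hx₀def, hydef])
    have h1 : Module.finrank ℂ (LinearMap.range (x₀ + c' • y)) = 3 := by
      rw [← hres, UnitaryLeviRank.finrank_range_restrict, hX₁Um]
    have h2 : Module.finrank ℂ (LinearMap.range y) = Module.finrank ℂ (Um.map Y) := by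
      rw [hydef, UnitaryLeviRank.finrank_range_restrict]
    omega
  -- STEP 8: every non-zero raising element of `L⁻` has rank `3` — impossible for type `(6 | 9)`
  have hconst : ∀ X ∈ 𝔊, Θ * X = X → X * Θ = -X → X * ι = ι * X →
      Module.finrank ℂ (Um.map X) = 0 ∨ Module.finrank ℂ (Um.map X) = 3 := by
    intro X hX hΘX hXΘ hXc
    obtain ⟨hi, hij⟩ := hprof X hX hΘX hXΘ hXc
    rcases hi with h | h
    · have hk := hK X hX hΘX hXΘ hXc h
      obtain ⟨hs, -, -⟩ := hsplit X hΘX hXc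
      have hr := hbad X hX hΘX hXΘ
      rw [hs, h] at hr
      omega
    · exact Or.inr (hij h)
  obtain ⟨A, hA, hιmA, hAιm, hAne, hA3⟩ :=
    UnitarySix.exists_raise_rank_ne_three hbrLm hirrLm hιmmem hιmιm hPm hQm hfinPm (by rw [hfinQm]; norm_num)
      (s := fun v w : Um => s (v : W) w) (hsU Um) (fun v w => hsymm v w) hPmQm hdefPm hdefQm hadjLm
  obtain ⟨Z, hZ, hZc, hAZ⟩ := (hLm A).1 hA
  have hZ1 : ∀ u ∈ Um, Θ (Z u) = Z u := fun u hu => by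
    have h := congrArg (fun T => ((T ⟨u, hu⟩ : Um) : W)) hιmA
    simp only [Module.End.mul_apply, hιmapply, hAZ] at h
    exact h
  have hZ2 : ∀ u ∈ Um, Z (Θ u) = -(Z u) := fun u hu => by
    have h := congrArg (fun T => ((T ⟨u, hu⟩ : Um) : W)) hAιm
    simp only [Module.End.mul_apply, LinearMap.neg_apply, Submodule.coe_neg, hAZ] at h
    rw [hιmapply] at h
    exact h
  obtain ⟨X, hX, hΘX, hXΘ, hXc, hXZ⟩ := UnitaryLeviLift.exists_raise_restrict hbr hΘ hΘΘ hιΘ hZ hZc hZ1 hZ2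
  have hxA : X.restrict (hcm X hXc) = A := LinearMap.ext fun v => Subtype.ext (by
    rw [LinearMap.coe_restrict_apply, hXZ v v.2, hAZ v])
  have hXUm : Module.finrank ℂ (Um.map X) = Module.finrank ℂ (LinearMap.range A) := by
    rw [← UnitaryLeviRank.finrank_range_restrict (hcm X hXc), hxA]
  have hA0 : Module.finrank ℂ (LinearMap.range A) ≠ 0 := fun h =>
    hAne (LinearMap.range_eq_bot.1 (Submodule.finrank_eq_zero.1 h))
  rcases hconst X hX hΘX hXΘ hXc with h | h
  · exact hA0 (hXUm ▸ h)
  · exact hA3 (hXUm ▸ h)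

/-- **The mirror core `(15, 8)`** (apply `eq_top_of_smul` to `−Θ`). [cite: Ribet1983, Thm. 3]
[cite: Gordon1997, Thm. 6.3 (3)] -/
theorem UnitaryEightFifteen.eq_top_of_smul' [FiniteDimensional ℂ W] {𝔊 : Submodule ℂ (Module.End ℂ W)}
    (hbr : ∀ Y ∈ 𝔊, ∀ Z ∈ 𝔊, Y * Z - Z * Y ∈ 𝔊)
    (hirr : ∀ U : Submodule ℂ W, (∀ A ∈ 𝔊, ∀ u ∈ U, A u ∈ U) → U = ⊥ ∨ U = ⊤)
    {Θ : Module.End ℂ W} (hΘ : Θ ∈ 𝔊) (hΘΘ : Θ * Θ = 1)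
    {P Q : Submodule ℂ W} (hP : ∀ x, x ∈ P ↔ Θ x = x) (hQ : ∀ x, x ∈ Q ↔ Θ x = -x)
    (hP15 : Module.finrank ℂ P = 15) (hQ8 : Module.finrank ℂ Q = 8)
    {s : W → W → ℂ} (hadd : ∀ x y z, s (x + y) z = s x z + s y z)
    (hsmul : ∀ (c : ℂ) (x y : W), s (c • x) y = c * s x y) (hsymm : ∀ x y, s y x = starRingEnd ℂ (s x y))
    (hPQ : ∀ p ∈ P, ∀ q ∈ Q, s p q = 0) (hdefP : ∀ p ∈ P, s p p = 0 → p = 0) (hdefQ : ∀ q ∈ Q, s q q = 0 → q = 0)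
    (hadj : ∀ X ∈ 𝔊, ∃ Y ∈ 𝔊, ∀ x y, s (X x) y = s x (Y y)) : 𝔊 = ⊤ := by
  have hnΘ : -Θ ∈ 𝔊 := Submodule.neg_mem _ hΘ
  have hnΘΘ : (-Θ) * (-Θ) = 1 := by rw [neg_mul_neg, hΘΘ]
  exact UnitaryEightFifteen.eq_top_of_smul hbr hirr hnΘ hnΘΘ (P := Q) (Q := P)
    (fun x => by rw [hQ, LinearMap.neg_apply, neg_eq_iff_eq_neg]) (fun x => by rw [hP, LinearMap.neg_apply, neg_inj])
    hQ8 hP15 hadd hsmul hsymm (fun p hp q hq => by rw [hsymm, hPQ q hq p hp, map_zero]) hdefQ hdefP hadj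

/-! ### §2 A corollary: the `(8 | 23)` core (31-folds of type `(8, 23)`) -/

/-- **The `(8 | 23)` core** — one Euclid step onto `(8 | 15)`: a raising operator onto `P` exists
(`UnitaryEight.exists_raise_onto_eight_of_smul`, `23` odd and prime to `3`), and the Levi algebra of its kernel
idempotent has type `(8 | 15)`. [cite: Ribet1983, Thm. 3] [cite: Gordon1997, Thm. 6.3 (3)]
[cite: Deligne1982HodgeCycles, I §3 Prop. 3.6] [cite: HoffmanKunze1971LinearAlgebra, §6.8 Thm. 12] -/
theorem UnitaryEight.eq_top_of_smul_twentythree [FiniteDimensional ℂ W] {𝔊 : Submodule ℂ (Module.End ℂ W)}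
    (hbr : ∀ Y ∈ 𝔊, ∀ Z ∈ 𝔊, Y * Z - Z * Y ∈ 𝔊)
    (hirr : ∀ U : Submodule ℂ W, (∀ A ∈ 𝔊, ∀ u ∈ U, A u ∈ U) → U = ⊥ ∨ U = ⊤)
    {Θ : Module.End ℂ W} (hΘ : Θ ∈ 𝔊) (hΘΘ : Θ * Θ = 1)
    {P Q : Submodule ℂ W} (hP : ∀ x, x ∈ P ↔ Θ x = x) (hQ : ∀ x, x ∈ Q ↔ Θ x = -x)
    (hP8 : Module.finrank ℂ P = 8) (hQ23 : Module.finrank ℂ Q = 23)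
    {s : W → W → ℂ} (hadd : ∀ x y z, s (x + y) z = s x z + s y z)
    (hsmul : ∀ (c : ℂ) (x y : W), s (c • x) y = c * s x y) (hsymm : ∀ x y, s y x = starRingEnd ℂ (s x y))
    (hPQ : ∀ p ∈ P, ∀ q ∈ Q, s p q = 0) (hdefP : ∀ p ∈ P, s p p = 0 → p = 0) (hdefQ : ∀ q ∈ Q, s q q = 0 → q = 0)
    (hadj : ∀ X ∈ 𝔊, ∃ Y ∈ 𝔊, ∀ x y, s (X x) y = s x (Y y)) : 𝔊 = ⊤ := by
  refine UnitaryCoprimeStep.eq_top_of_onto_of_core hbr hirr hΘ hΘΘ hP hQ hP8 hQ23 (by norm_num) (by norm_num) hadd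
    hsymm hPQ hdefP hdefQ hadj ?_ ?_
  · exact UnitaryEight.exists_raise_onto_eight_of_smul hbr hirr hΘ hΘΘ hP hQ hP8 (by rw [hQ23]; norm_num)
      ⟨11, by rw [hQ23]; norm_num⟩ (by rw [hQ23]; norm_num) hadd hsmul hsymm hPQ hdefP hdefQ hadj
  · intro 𝔩 ι P' Q' hbr𝔩 hirr𝔩 hι hιι hP' hQ' hfinP' hfinQ' hP'Q' hdefP' hdefQ' hadj𝔩
    exact UnitaryEightFifteen.eq_top_of_smul hbr𝔩 hirr𝔩 hι hιι hP' hQ' hfinP' (by rw [hfinQ'])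
      (s := fun x y : Q => s (x : W) y) (fun x y z => by simp only [Submodule.coe_add, hadd])
      (fun c x y => by simp only [Submodule.coe_smul, hsmul]) (fun x y => hsymm x y) hP'Q' hdefP' hdefQ' hadj𝔩

/-- **The mirror core `(23, 8)`** (apply `eq_top_of_smul_twentythree` to `−Θ`). [cite: Ribet1983, Thm. 3]
[cite: Gordon1997, Thm. 6.3 (3)] -/
theorem UnitaryEight.eq_top_of_smul_twentythree' [FiniteDimensional ℂ W] {𝔊 : Submodule ℂ (Module.End ℂ W)}
    (hbr : ∀ Y ∈ 𝔊, ∀ Z ∈ 𝔊, Y * Z - Z * Y ∈ 𝔊)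
    (hirr : ∀ U : Submodule ℂ W, (∀ A ∈ 𝔊, ∀ u ∈ U, A u ∈ U) → U = ⊥ ∨ U = ⊤)
    {Θ : Module.End ℂ W} (hΘ : Θ ∈ 𝔊) (hΘΘ : Θ * Θ = 1)
    {P Q : Submodule ℂ W} (hP : ∀ x, x ∈ P ↔ Θ x = x) (hQ : ∀ x, x ∈ Q ↔ Θ x = -x)
    (hP23 : Module.finrank ℂ P = 23) (hQ8 : Module.finrank ℂ Q = 8)
    {s : W → W → ℂ} (hadd : ∀ x y z, s (x + y) z = s x z + s y z)
    (hsmul : ∀ (c : ℂ) (x y : W), s (c • x) y = c * s x y) (hsymm : ∀ x y, s y x = starRingEnd ℂ (s x y))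
    (hPQ : ∀ p ∈ P, ∀ q ∈ Q, s p q = 0) (hdefP : ∀ p ∈ P, s p p = 0 → p = 0) (hdefQ : ∀ q ∈ Q, s q q = 0 → q = 0)
    (hadj : ∀ X ∈ 𝔊, ∃ Y ∈ 𝔊, ∀ x y, s (X x) y = s x (Y y)) : 𝔊 = ⊤ := by
  have hnΘ : -Θ ∈ 𝔊 := Submodule.neg_mem _ hΘ
  have hnΘΘ : (-Θ) * (-Θ) = 1 := by rw [neg_mul_neg, hΘΘ]
  exact UnitaryEight.eq_top_of_smul_twentythree hbr hirr hnΘ hnΘΘ (P := Q) (Q := P)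
    (fun x => by rw [hQ, LinearMap.neg_apply, neg_eq_iff_eq_neg]) (fun x => by rw [hP, LinearMap.neg_apply, neg_inj])
    hQ8 hP23 hadd hsmul hsymm (fun p hp q hq => by rw [hsymm, hPQ q hq p hp, map_zero]) hdefQ hdefP hadj

end HodgeStructure

end Literature.AlgebraicGeometry.Motives
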